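import Mathlib
import Summits.Ventures.PercRepro2.Independence
import Summits.Ventures.PercRepro2.Harris
import Summits.Ventures.PercRepro2.HCov
import Summits.Ventures.PercRepro2.CutVertexPaths
import Summits.Ventures.PercRepro2.CutOneFarConn
import Summits.Ventures.PercRepro2.CutTwoFarConn
import Summits.Ventures.PercRepro2.CutTwoFarLaw
import Summits.Ventures.PercRepro2.CutTwoFar
import Summits.Ventures.PercRepro2.CutTwoFarHarris
import Summits.Ventures.PercRepro2.CutTwoFarRootsLaw
import Summits.Ventures.PercRepro2.CutTwoFarRightPat

/-!
# A root and `b` behind a cut vertex, I: MARK CONNECTIVITY (blind cell PercRepro2, typer-1 g50)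

With `v` a cut vertex, `a₁, b` on the left and `a₂, a₃, o` on the right (or at `v`), every
connection between two marks is a Boolean function of the left pattern of `{v, a₁, b}` (`pat`) and
the right pattern of `{v, a₂, a₃, o}` (`rpat`, with `y₁ = a₂`, `y₂ = a₃`, `y₃ = o`) (`rb_conn_*`).
Part I of the reduction of the class T7 (MINE2-CUTVERTEX §13.2 / §13.8, S3.5 `{a₁, b}`).  Own
work; standard axioms.
-/

namespace Summit.Ventures.PercRepro2

open CovForm CutVertexM9 UnionCluster

namespace CutTwoFar

section RBConn

variable {V : Type*} {E : Type*} [Fintype E] [DecidableEq E] {R : Type*} [Field R]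
variable {ends : E → Sym2 V} {side : E → Bool} {L : Set V} {v : V} {Rt : Set V}

variable (h : CutVertex ends side L v Rt) {o b a₁ a₂ a₃ : V}
include h

omit [Fintype E] [DecidableEq E] in
/-- `a₁ ↔ o`: the left bit `a₁ ↔ v` and the right bit `v ↔ o`. -/
lemma rb_conn_a₁_o (h1 : a₁ ∈ L ∨ a₁ = v) (ho : o ∈ Rt ∨ o = v) (ω : Config E) :
    Conn ends ω a₁ o ↔ pat ends side v a₁ b ω 0 = true ∧ rpat ends side v a₂ a₃ o ω 2 = true := by
  rw [conn_left_right_iff h h1 ho ω, pat_zero_iff, Rb_eq_true_iff, rpat_two_iff]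

omit [Fintype E] [DecidableEq E] in
/-- `a₂ ↔ o`. -/
lemma rb_conn_a₂_o (h2 : a₂ ∈ Rt ∨ a₂ = v) (ho : o ∈ Rt ∨ o = v) (ω : Config E) :
    Conn ends ω a₂ o ↔ rpat ends side v a₂ a₃ o ω 4 = true := by
  rw [conn_right_iff h h2 ho ω, rpat_four_iff]

omit [Fintype E] [DecidableEq E] in
/-- `o ↔ a₂`. -/
lemma rb_conn_o_a₂ (h2 : a₂ ∈ Rt ∨ a₂ = v) (ho : o ∈ Rt ∨ o = v) (ω : Config E) :
    Conn ends ω o a₂ ↔ rpat ends side v a₂ a₃ o ω 4 = true := by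
  rw [conn_right_iff h ho h2 ω, rpat_four_iff]
  exact ⟨conn_symm, conn_symm⟩

omit [Fintype E] [DecidableEq E] in
/-- `a₁ ↔ b`: the left bit `2`. -/
lemma rb_conn_a₁_b (h1 : a₁ ∈ L ∨ a₁ = v) (hb : b ∈ L ∨ b = v) (ω : Config E) :
    Conn ends ω a₁ b ↔ pat ends side v a₁ b ω 2 = true := by
  rw [conn_iff_restrict_left h h1 hb ω, pat_two_iff]

omit [Fintype E] [DecidableEq E] in
/-- `a₂ ↔ b`. -/
lemma rb_conn_a₂_b (hb : b ∈ L ∨ b = v) (h2 : a₂ ∈ Rt ∨ a₂ = v) (ω : Config E) :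
    Conn ends ω a₂ b ↔ pat ends side v a₁ b ω 1 = true ∧ rpat ends side v a₂ a₃ o ω 0 = true := by
  rw [show Conn ends ω a₂ b ↔ Conn ends ω b a₂ from ⟨conn_symm, conn_symm⟩,
    conn_left_right_iff h hb h2 ω, pat_one_iff, Rb_eq_true_iff, rpat_zero_iff]

omit [Fintype E] [DecidableEq E] in
/-- `a₁ ↔ v`: the left bit `0`. -/
lemma rb_conn_a₁_v (h1 : a₁ ∈ L ∨ a₁ = v) (ω : Config E) :
    Conn ends ω a₁ v ↔ pat ends side v a₁ b ω 0 = true := by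
  rw [conn_iff_restrict_left h h1 (Or.inr rfl) ω, pat_zero_iff]

omit [Fintype E] [DecidableEq E] in
/-- `a₂ ↔ v`. -/
lemma rb_conn_a₂_v (h2 : a₂ ∈ Rt ∨ a₂ = v) (ω : Config E) :
    Conn ends ω a₂ v ↔ rpat ends side v a₂ a₃ o ω 0 = true := by
  rw [conn_right_iff h h2 (Or.inr rfl) ω, rpat_zero_iff]
  exact ⟨conn_symm, conn_symm⟩

omit [Fintype E] [DecidableEq E] in
/-- `v ↔ a₂`. -/
lemma rb_conn_v_a₂ (h2 : a₂ ∈ Rt ∨ a₂ = v) (ω : Config E) :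
    Conn ends ω v a₂ ↔ rpat ends side v a₂ a₃ o ω 0 = true := by
  rw [conn_right_iff h (Or.inr rfl) h2 ω, rpat_zero_iff]

omit [Fintype E] [DecidableEq E] in
/-- `a₂ ↔ a₁`. -/
lemma rb_conn_a₂_a₁ (h1 : a₁ ∈ L ∨ a₁ = v) (h2 : a₂ ∈ Rt ∨ a₂ = v) (ω : Config E) :
    Conn ends ω a₂ a₁ ↔ pat ends side v a₁ b ω 0 = true ∧ rpat ends side v a₂ a₃ o ω 0 = true := by
  rw [show Conn ends ω a₂ a₁ ↔ Conn ends ω a₁ a₂ from ⟨conn_symm, conn_symm⟩,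
    conn_left_right_iff h h1 h2 ω, pat_zero_iff, Rb_eq_true_iff, rpat_zero_iff]

omit [Fintype E] [DecidableEq E] in
/-- `a₁ ↔ a₂`. -/
lemma rb_conn_a₁_a₂ (h1 : a₁ ∈ L ∨ a₁ = v) (h2 : a₂ ∈ Rt ∨ a₂ = v) (ω : Config E) :
    Conn ends ω a₁ a₂ ↔ pat ends side v a₁ b ω 0 = true ∧ rpat ends side v a₂ a₃ o ω 0 = true := by
  rw [conn_left_right_iff h h1 h2 ω, pat_zero_iff, Rb_eq_true_iff, rpat_zero_iff]

omit [Fintype E] [DecidableEq E] in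
/-- `a₃ ↔ a₁`. -/
lemma rb_conn_a₃_a₁ (h1 : a₁ ∈ L ∨ a₁ = v) (h3 : a₃ ∈ Rt ∨ a₃ = v) (ω : Config E) :
    Conn ends ω a₃ a₁ ↔ pat ends side v a₁ b ω 0 = true ∧ rpat ends side v a₂ a₃ o ω 1 = true := by
  rw [show Conn ends ω a₃ a₁ ↔ Conn ends ω a₁ a₃ from ⟨conn_symm, conn_symm⟩,
    conn_left_right_iff h h1 h3 ω, pat_zero_iff, Rb_eq_true_iff, rpat_one_iff]

omit [Fintype E] [DecidableEq E] in
/-- `a₁ ↔ a₃`. -/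
lemma rb_conn_a₁_a₃ (h1 : a₁ ∈ L ∨ a₁ = v) (h3 : a₃ ∈ Rt ∨ a₃ = v) (ω : Config E) :
    Conn ends ω a₁ a₃ ↔ pat ends side v a₁ b ω 0 = true ∧ rpat ends side v a₂ a₃ o ω 1 = true := by
  rw [conn_left_right_iff h h1 h3 ω, pat_zero_iff, Rb_eq_true_iff, rpat_one_iff]

omit [Fintype E] [DecidableEq E] in
/-- `a₃ ↔ a₂`. -/
lemma rb_conn_a₃_a₂ (h2 : a₂ ∈ Rt ∨ a₂ = v) (h3 : a₃ ∈ Rt ∨ a₃ = v) (ω : Config E) :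
    Conn ends ω a₃ a₂ ↔ rpat ends side v a₂ a₃ o ω 3 = true := by
  rw [conn_right_iff h h3 h2 ω, rpat_three_iff]
  exact ⟨conn_symm, conn_symm⟩

omit [Fintype E] [DecidableEq E] in
/-- `a₂ ↔ a₃`. -/
lemma rb_conn_a₂_a₃ (h2 : a₂ ∈ Rt ∨ a₂ = v) (h3 : a₃ ∈ Rt ∨ a₃ = v) (ω : Config E) :
    Conn ends ω a₂ a₃ ↔ rpat ends side v a₂ a₃ o ω 3 = true := by
  rw [conn_right_iff h h2 h3 ω, rpat_three_iff]

omit [Fintype E] [DecidableEq E] in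
/-- `o ↔ v`. -/
lemma rb_conn_o_v (ho : o ∈ Rt ∨ o = v) (ω : Config E) :
    Conn ends ω o v ↔ rpat ends side v a₂ a₃ o ω 2 = true := by
  rw [conn_right_iff h ho (Or.inr rfl) ω, rpat_two_iff]
  exact ⟨conn_symm, conn_symm⟩

omit [Fintype E] [DecidableEq E] in
/-- `a₃ ↔ v`. -/
lemma rb_conn_a₃_v (h3 : a₃ ∈ Rt ∨ a₃ = v) (ω : Config E) :
    Conn ends ω a₃ v ↔ rpat ends side v a₂ a₃ o ω 1 = true := by
  rw [conn_right_iff h h3 (Or.inr rfl) ω, rpat_one_iff]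
  exact ⟨conn_symm, conn_symm⟩

end RBConn

end CutTwoFar

end Summit.Ventures.PercRepro2
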